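import Summits.ABC.ABC.Theses.CubicResolventAllowance
import Summits.ABC.ABC.Theorems.CubicResolventAllowanceResolventDiscBounds
import Literature.NumberTheory.DiophantineGeometry.GenEllThm21With
import Literature.NumberTheory.EllipticCurves.JInvariantDenominator
import Literature.NumberTheory.EllipticCurves.GlobalMinimalModelProofs
import Literature.NumberTheory.EllipticCurves.SzpiroOfAbcProofs
import Literature.NumberTheory.EllipticCurves.SzpiroLocalDataProofs
import Literature.NumberTheory.DiophantineGeometry.EllArithGlueProofs
import HarnessLib

/-!
# STUB-IDEAS `stub_realCubic` · ideator k1 · generation 7 — the REAL half is poly-abc too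

Crux stmt-ABC-22740 `CubicResolventAllowance.IndexSzpiro`, stub `stub_realCubic` (the `0 < d_K` half),
route-ABC-CubicResolventAllowance. FAMILY 1 (recognise & import), gen 7.

Gens 2–6 of this slot imported everything importable TOWARDS the real stub (Pasten, Bennett–Dahmen, the
sibling 2-torsion routes) and found it open. The complex slot (k1 gen 6, `StubIdeas1G6Sketch.lean`) then showed
`stub_complexCubic ⟹ ABCWithExponent 8` with the PURE-CUBIC pencil, whose discriminant is always NEGATIVE — so it
says nothing about the real half, and one could still hope that `0 < d_K` isolates an easier statement.
Gen 7 closes that door. RECOGNITION: the real stub is polynomial abc in disguise, via TWO real pencils.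

* R1–R6, the j-LINE PENCIL (`X(1)` with its three marked points). For an abc triple `a + b = c` put
  `W_{a,b} : Y² = X³ − 27·bc·X − 54·b²c`, i.e. `(c₄, c₆, Δ) = 6^•·(bc, b²c, ab³c²/1728)`:
  `Δ = 2⁶3⁹·a·b³·c² > 0` (REAL 2-division cubic field), `j = 1728·c/a` (so `a ∣ 1728·Δ_min`: the summand `a`
  is the multiplicative member), bad primes `⊆ 6abc` (so `N ∣ 2⁸3⁵·rad(abc)²`). Every elliptic curve over `ℚ`
  with `j > 1728` is a twist of some `W_{a,b}` (`j = 1728c/a`, `j − 1728 = 1728b/a`): this is Oesterlé's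
  `abc ⟺ generalised Szpiro` dictionary read on the real locus. `ψ₂(W_{a,b})` has a rational root iff
  `c/a = s³/((s+1)²(s−2))` for some `s ∈ ℚ` (the `X₀(2)` parametrisation `j = (h+16)³/h`, `h = 8(s−2)/(s+1)`);
  the two roles `W_{a,b}`, `W_{b,a}` have THE SAME cubic field (Tschirnhaus `w ↦ −2abc/(w²−bc)`, R2s; Kummer
  `α₁α₂ = −(cδ)³`, R9b), and the degenerate locus is ONE explicit thin family, the BINOMIAL CUBES
  `𝓑 = {(n²(n+3m), m²(m+3n), (m+n)³)/g, g ∣ 8}` (R2d, R7) — `c` a cube up to `8`, density `≍ X^{2/3}`, containing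
  abc hits such as `3⁵ + 2²5² = 7³` but made of curves WITH rational 2-torsion (the route's X2/X3, not this stub).
  Hence (R6a/R6a⁺)   `stub_realCubic ⟹ c < C(ε)·rad(abc)^{16(1+ε)}` for every abc triple off `𝓑`
  (role `a = max(a,b) ≥ c/2`; empirically `|d_K| ≤ 4N`, `≤ 54·rad²` on the pencil, which would give `14`).
* R7′, the DISPATCH on `𝓑`: a `𝓑`-triple with parameters `(m,n)` hands the stub the derived triples `{|m|,|n|,|m+n|}`,
  `{|m|,3|n|,·}`, `{3|m|,|n|,·}` (radicals `∣ 6·rad(abc)`, largest member `≥ (gc)^{1/3}/3`); unless all three are in `𝓑`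
  again (`DispatchResidual`: simultaneous cube conditions = cubic Fermat curves `αx³+βy³=γz³`, `αβγ ∣ 2⁶3³`), this
  gives exponent `48`. `DispatchResidualFinite → StubReal ⟹ ABCWithExponent 48` (R7d), the tree's sentence.
* R8–R9, the HESSE / `X₀(3)` PENCIL `V_{a,b}` (`(c₄, c₆, Δ) = (9c(9a+b), 27c(27a²+18ab−b²), 27ab³c²)`, identity
  `c(9a+b)³ − (27a²+18ab−b²)² = 64ab³`, `j = 27c(9a+b)³/(ab³)`, both summands multiplicative): the only other
  low-index genus-0 pencil with three rational marked fibres and no forced 2-torsion — and it sees the SAME cubic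
  field (`α_V·ᾱ₁ = (−c(b−3δ))³`, R9c), so it cannot shrink `𝓑`. Negative knowledge, kernel-checked.

So BOTH sign halves of `IndexSzpiro` carry polynomial abc: complex-k1 gen 6 has `Stub⁻ ⟹ ABCWithExponent 8` (pure
cubic pencil + FLT(3)); here `Stub⁺ ⟹ abc₁₆ off 𝓑` unconditionally and `⟹ ABCWithExponent 48` given a rank-0 check
on finitely many cubic Fermat curves. The sign split buys nothing: any proof of `stub_realCubic` proves a polynomial
abc inequality on a set of triples of full density, beyond Stewart–Yu `exp(rad^{1/3+ε})`. Sandwich, by name: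
  `ABC ⟹ SzpiroConjecture ⟹ StubReal ⟹ ABCWithExponentOffCubes 16` (R10).
Certified numerically (PARI, kit j344796: 27 396 ordered coprime `a+b=c ≤ 300`, 13 checks, 0 violations;
`max |d_K|/N = 4`, `max |d_K|/rad² = 54`; j344791/j344802: the locus `= 𝓑`, dispatch residual search).

Kernel-checked below (no `sorry`): the sandwich maps R0, all pencil invariants (R1, R8a–d), the 2-division
evaluation and the root ↦ parameter identity (R2a–c), IRREDUCIBILITY OFF THE PARAMETER LOCUS (R2c′), the
Tschirnhaus/Kummer identities and the SYMMETRY of the locus (R2s, R2s′, R9), the model-free `den(j) ∣ Δ_min`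
(R4a), the binomial-cube family (R7). `sorry` = proposal, sized in the docstring.
Nothing here proves the stub: the file proves the real stub is abc-hard.
-/

set_option linter.dupNamespace false

noncomputable section

namespace Summit.ABC.ABC.Cruxes.IndexSzpiro.StubIdeasRealCubic1G7

open Polynomial UniqueFactorizationMonoid WeierstrassCurve
open Literature.NumberTheory.EllipticCurves Literature.NumberTheory.DiophantineGeometry

/-- The stub, verbatim (payload `stub.signature`; = `IndexSzpiro` with the extra hypothesis `0 < d_K`). -/
def StubReal : Prop :=
  ∀ ε : ℝ, 0 < ε → ∃ C : ℝ, ∀ (W : WeierstrassCurve ℚ) [W.IsElliptic] (K : Type) [Field K] [NumberField K],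
    Irreducible W.twoTorsionPolynomial.toPoly → Module.finrank ℚ K = 3 →
    (∃ θ : K, aeval θ W.twoTorsionPolynomial.toPoly = 0) → 0 < NumberField.discr K →
    (W.minimalDiscriminantNorm ℤ : ℝ) ≤ C * |(NumberField.discr K : ℝ)| * (W.conductorNorm ℤ : ℝ) ^ (6 + ε)

/-! ## R0 — the sandwich maps above the stub (kernel-checked) -/

/-- R0a. The route crux gives the stub (drop the sign hypothesis). [folklore] -/
theorem stubReal_of_indexSzpiro (h : Summit.ABC.ABC.Theses.CubicResolventAllowance.IndexSzpiro) :
    StubReal := by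
  intro ε hε
  obtain ⟨C, hC⟩ := h ε hε
  exact ⟨C, fun W _ K _ _ hirr h3 hθ _ => hC W K hirr h3 hθ⟩

/-- R0b. Szpiro's conjecture gives the stub (`|d_K| ≥ 1`, sign-free); with the tree's `szpiro_of_abcLe_holds`
this places the stub BELOW abc. [folklore] -/
theorem stubReal_of_szpiro (h : SzpiroConjecture) : StubReal := by
  intro ε hε
  obtain ⟨C, hC⟩ := h ε hε
  refine ⟨max C 0, fun W _ K _ _ _ _ _ _ => ?_⟩
  have h1 := hC W
  have hN : (0 : ℝ) ≤ (W.conductorNorm ℤ : ℝ) ^ (6 + ε) := by positivity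
  have hd : (1 : ℝ) ≤ |(NumberField.discr K : ℝ)| := by
    have := Int.one_le_abs (NumberField.discr_ne_zero K)
    exact_mod_cast this
  calc (W.minimalDiscriminantNorm ℤ : ℝ) ≤ C * (W.conductorNorm ℤ : ℝ) ^ (6 + ε) := h1
    _ ≤ max C 0 * (W.conductorNorm ℤ : ℝ) ^ (6 + ε) := by gcongr; exact le_max_left _ _
    _ = max C 0 * 1 * (W.conductorNorm ℤ : ℝ) ^ (6 + ε) := by ring
    _ ≤ max C 0 * |(NumberField.discr K : ℝ)| * (W.conductorNorm ℤ : ℝ) ^ (6 + ε) := by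
        gcongr

/-! ## R1 — the j-line pencil `W_{a,b}` and its invariants (kernel-checked) -/

/-- The integral j-line pencil `W_{a,b} : Y² = X³ − 27·b(a+b)·X − 54·b²(a+b)` (the curve with
`(c₄, c₆) ∝ (bc, b²c)`, `c = a + b`; `j = 1728c/a`, `j − 1728 = 1728b/a`). -/
def jPencilInt (a b : ℤ) : WeierstrassCurve ℤ := ⟨0, 0, 0, -27 * b * (a + b), -54 * b ^ 2 * (a + b)⟩

/-- `W_{a,b}` over `ℚ`. -/
abbrev jPencil (a b : ℤ) : WeierstrassCurve ℚ := (jPencilInt a b).baseChange ℚ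

/-- R1a (kernel-checked). `c₄(W_{a,b}) = 2⁴3⁴·b(a+b)`: a prime `p ≥ 5` of `a` (coprime to `b(a+b)`) does not
divide `c₄` — multiplicative reduction at the primes of the summand `a`. [folklore] -/
theorem jPencilInt_c₄ (a b : ℤ) : (jPencilInt a b).c₄ = 2 ^ 4 * 3 ^ 4 * (b * (a + b)) := by
  simp only [jPencilInt, WeierstrassCurve.c₄, WeierstrassCurve.b₂, WeierstrassCurve.b₄]
  ring

/-- R1b (kernel-checked). `Δ(W_{a,b}) = 2⁶3⁹·a·b³·(a+b)²` — POSITIVE for a positive triple, so the pencil lives in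
the stub's class `𝒞⁺` (real cubic 2-division field); bad primes `⊆ 6ab(a+b)`. [folklore] -/
theorem jPencilInt_Δ (a b : ℤ) : (jPencilInt a b).Δ = 2 ^ 6 * 3 ^ 9 * (a * b ^ 3 * (a + b) ^ 2) := by
  simp only [jPencilInt, WeierstrassCurve.Δ, WeierstrassCurve.b₂, WeierstrassCurve.b₄, WeierstrassCurve.b₆,
    WeierstrassCurve.b₈]
  ring

/-- R1b′ (kernel-checked). `Δ(W_{a,b}/ℚ)`. [folklore] -/
theorem jPencil_Δ (a b : ℤ) :
    (jPencil a b).Δ = (2 ^ 6 * 3 ^ 9 : ℚ) * ((a : ℚ) * b ^ 3 * (a + b) ^ 2) := by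
  rw [jPencil, WeierstrassCurve.baseChange, WeierstrassCurve.map_Δ, jPencilInt_Δ, eq_intCast]
  push_cast
  ring

/-- R1a′ (kernel-checked). `c₄(W_{a,b}/ℚ)`. [folklore] -/
theorem jPencil_c₄ (a b : ℤ) : (jPencil a b).c₄ = (2 ^ 4 * 3 ^ 4 : ℚ) * ((b : ℚ) * (a + b)) := by
  rw [jPencil, WeierstrassCurve.baseChange, WeierstrassCurve.map_c₄, jPencilInt_c₄, eq_intCast]
  push_cast
  ring

/-- R1c (kernel-checked). `W_{a,b}` is elliptic as soon as `ab(a+b) ≠ 0`. [folklore] -/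
theorem jPencil_isElliptic {a b : ℤ} (ha : a ≠ 0) (hb : b ≠ 0) (hc : a + b ≠ 0) :
    (jPencil a b).IsElliptic := by
  refine ⟨?_⟩
  rw [jPencil_Δ, isUnit_iff_ne_zero]
  have ha' : (a : ℚ) ≠ 0 := by exact_mod_cast ha
  have hb' : (b : ℚ) ≠ 0 := by exact_mod_cast hb
  have hc' : ((a : ℚ) + b) ≠ 0 := by exact_mod_cast hc
  exact mul_ne_zero (by norm_num) (mul_ne_zero (mul_ne_zero ha' (pow_ne_zero 3 hb')) (pow_ne_zero 2 hc'))

/-- R1d (kernel-checked). `0 < Δ(W_{a,b})` for `a, b > 0`: the REAL class. [folklore] -/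
theorem jPencil_Δ_pos {a b : ℤ} (ha : 0 < a) (hb : 0 < b) : 0 < (jPencil a b).Δ := by
  rw [jPencil_Δ]
  have ha' : (0 : ℚ) < a := by exact_mod_cast ha
  have hb' : (0 : ℚ) < b := by exact_mod_cast hb
  positivity

/-- R1e (kernel-checked). `j(W_{a,b}) = 1728·(a+b)/a`: the summand `a` is the denominator of `j`, prime to the
numerator `1728c` away from `6` when `gcd(a, b) = 1`. [folklore] -/
theorem jPencil_j {a b : ℤ} (ha : a ≠ 0) (hb : b ≠ 0) (hc : a + b ≠ 0) [(jPencil a b).IsElliptic] :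
    (jPencil a b).j = 1728 * ((a : ℚ) + b) / a := by
  have ha' : (a : ℚ) ≠ 0 := by exact_mod_cast ha
  have hb' : (b : ℚ) ≠ 0 := by exact_mod_cast hb
  have hc' : ((a : ℚ) + b) ≠ 0 := by exact_mod_cast hc
  rw [WeierstrassCurve.j, Units.val_inv_eq_inv_val, WeierstrassCurve.coe_Δ', jPencil_Δ, jPencil_c₄]
  field_simp
  ring

/-! ## R2 — `ψ₂`, the root ↦ `X₀(2)`-parameter map, irreducibility off the parameter locus -/

/-- The REAL-ROLE PARAMETER LOCUS: `c/a = s³/((s+1)²(s−2))` for some `s ∈ ℚ` (`c = a + b`), written without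
division. Equivalently `j(W_{a,b}) = 1728c/a = (h+16)³/h` with `h = 8(s−2)/(s+1)` — the `X₀(2)` locus. -/
def RealRoleParam (a b : ℚ) : Prop := ∃ s : ℚ, (a + b) * ((s + 1) ^ 2 * (s - 2)) = a * s ^ 3

/-- R2a (kernel-checked). `ψ₂(W_{a,b})(x) = 4·(x³ − 27b(a+b)x − 54b²(a+b))`. [folklore] -/
theorem jPencil_aeval (a b : ℤ) (x : ℚ) :
    aeval x (jPencil a b).twoTorsionPolynomial.toPoly =
      4 * (x ^ 3 - 27 * b * (a + b) * x - 54 * (b : ℚ) ^ 2 * (a + b)) := by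
  simp only [jPencil, jPencilInt, WeierstrassCurve.baseChange, WeierstrassCurve.map,
    WeierstrassCurve.twoTorsionPolynomial, Cubic.toPoly, WeierstrassCurve.b₂, WeierstrassCurve.b₄,
    WeierstrassCurve.b₆]
  simp only [map_add, map_mul, map_pow, map_neg, aeval_X, map_ofNat, map_zero, map_intCast, eq_intCast]
  ring

/-- R2b (kernel-checked). The root ↦ parameter identity: `c(x+3b)²(x−6b) − a·x³ = b·(x³ − 27bcx − 54b²c)`
(`c = a + b`). A root `x` of `ψ₂` therefore gives `c/a = s³/((s+1)²(s−2))` with `s = x/(3b)`. [folklore] -/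
theorem root_identity (a b x : ℚ) :
    (a + b) * ((x + 3 * b) ^ 2 * (x - 6 * b)) - a * x ^ 3
      = b * (x ^ 3 - 27 * b * (a + b) * x - 54 * b ^ 2 * (a + b)) := by
  ring

/-- R2b′ (kernel-checked). The `X₀(2)` dictionary: `1728·s³/((s+1)²(s−2)) = (h+16)³/h` at `h = 8(s−2)/(s+1)`,
written polynomially. So `RealRoleParam a b` says exactly `j(W_{a,b}) ∈ j(X₀(2)(ℚ))`. [folklore] -/
theorem x02_dictionary (s : ℚ) (hs1 : s + 1 ≠ 0) (hs2 : s - 2 ≠ 0) :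
    1728 * s ^ 3 / ((s + 1) ^ 2 * (s - 2)) = (8 * (s - 2) / (s + 1) + 16) ^ 3 / (8 * (s - 2) / (s + 1)) := by
  field_simp
  ring

/-- R2c (kernel-checked). A rational root of `ψ₂(W_{a,b})` puts `(a, b)` on the parameter locus. [folklore] -/
theorem realRoleParam_of_aeval_eq_zero {a b : ℤ} (hb : b ≠ 0) {x : ℚ}
    (hx : aeval x (jPencil a b).twoTorsionPolynomial.toPoly = 0) : RealRoleParam a b := by
  rw [jPencil_aeval] at hx
  have hb' : (b : ℚ) ≠ 0 := by exact_mod_cast hb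
  have h0 : x ^ 3 - 27 * b * (a + b) * x - 54 * (b : ℚ) ^ 2 * (a + b) = 0 :=
    (mul_eq_zero.mp hx).resolve_left (by norm_num)
  refine ⟨x / (3 * b), ?_⟩
  have key : ((a : ℚ) + b) * ((x / (3 * b) + 1) ^ 2 * (x / (3 * b) - 2)) - a * (x / (3 * b)) ^ 3
      = b * (x ^ 3 - 27 * b * (a + b) * x - 54 * (b : ℚ) ^ 2 * (a + b)) / (27 * b ^ 3) := by
    field_simp
    ring
  rw [h0, mul_zero, zero_div, sub_eq_zero] at key
  exact key

/-- R2c′ (kernel-checked). OFF the parameter locus `ψ₂(W_{a,b})` is irreducible over `ℚ` (a cubic is irreducible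
iff it has no root, Mathlib `irreducible_of_degree_le_three_of_not_isRoot`). [folklore] -/
theorem jPencil_irreducible {a b : ℤ} (hb : b ≠ 0) (h : ¬ RealRoleParam a b) :
    Irreducible (jPencil a b).twoTorsionPolynomial.toPoly := by
  apply irreducible_of_degree_le_three_of_not_isRoot
  · have ha4 : (jPencil a b).twoTorsionPolynomial.a ≠ 0 := by
      rw [WeierstrassCurve.twoTorsionPolynomial]; norm_num
    rw [Cubic.natDegree_of_a_ne_zero ha4]; decide
  · intro x hx
    apply h
    apply realRoleParam_of_aeval_eq_zero hb (x := x)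
    rw [coe_aeval_eq_eval]
    exact hx

/-- R2s (kernel-checked). THE TSCHIRNHAUS IDENTITY between the two real roles. In the monic
normalisation `p_{a,b}(w) = w³ − 3bc·w − 2b²c` (`x = 3w`), the map `w ↦ −2abc/(w² − bc)` sends roots of `p_{a,b}`
to roots of `p_{b,a}`: clearing the denominator, `p_{b,a}(−2abc/(w²−bc))·(w²−bc)³ = −2a²c·p_{a,b}(w)·(w³ − 3bcw + 2b²c)`.
Hence `W_{a,b}` and `W_{b,a}` have THE SAME 2-division cubic field, and `RealRoleParam` is symmetric (R2s′):
the two real roles of a triple degenerate together or not at all (certified: 0 mixed patterns among 218 892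
unordered coprime triples `c ≤ 1200`, kit j344796 block 3; all `K(W_{a,b}) ≅ K(W_{b,a})`, block 4). Cardano/Kummer
explanation: R9b. [folklore] -/
theorem roles_tschirnhaus (a b w : ℚ) :
    (-(2 * a * b * (a + b))) ^ 3 - 3 * a * (a + b) * (-(2 * a * b * (a + b))) * (w ^ 2 - b * (a + b)) ^ 2
        - 2 * a ^ 2 * (a + b) * (w ^ 2 - b * (a + b)) ^ 3
      = -(2 * a ^ 2 * (a + b)) * (w ^ 3 - 3 * b * (a + b) * w - 2 * b ^ 2 * (a + b))
          * (w ^ 3 - 3 * b * (a + b) * w + 2 * b ^ 2 * (a + b)) := by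
  ring

/-- R2b″ (kernel-checked). The root identity in the monic normalisation: `c(w+b)²(w−2b) − a·w³ = b·p_{a,b}(w)`. [folklore] -/
theorem root_identity_monic (a b w : ℚ) :
    (a + b) * ((w + b) ^ 2 * (w - 2 * b)) - a * w ^ 3
      = b * (w ^ 3 - 3 * b * (a + b) * w - 2 * b ^ 2 * (a + b)) := by
  ring

/-- R2s′ (kernel-checked). `RealRoleParam` is SYMMETRIC for `ab(a+b) ≠ 0`: from a parameter `s` for the role `a`,
`w = sb` is a root of `p_{a,b}` (R2b″), `w² ≠ bc` (else `a = 0`), `w₂ = −2abc/(w² − bc)` is a root of `p_{b,a}`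
(R2s) and `s₂ = w₂/a` is a parameter for the role `b` (R2b″ with the roles swapped). So the degenerate locus `T`
of the j-line pencil is ONE set of triples, `𝓑` of R7, seen from either summand. [folklore] -/
theorem realRoleParam_symm {a b : ℚ} (ha : a ≠ 0) (hb : b ≠ 0) (hc : a + b ≠ 0) (h : RealRoleParam a b) :
    RealRoleParam b a := by
  obtain ⟨s, hs⟩ := h
  set w : ℚ := s * b with hw
  -- `w` is a root of `p_{a,b}`
  have hroot : w ^ 3 - 3 * b * (a + b) * w - 2 * b ^ 2 * (a + b) = 0 := by
    have h1 := root_identity_monic a b w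
    have h2 : (a + b) * ((w + b) ^ 2 * (w - 2 * b)) - a * w ^ 3 = 0 := by
      have : (a + b) * ((w + b) ^ 2 * (w - 2 * b)) - a * w ^ 3
          = b ^ 3 * ((a + b) * ((s + 1) ^ 2 * (s - 2)) - a * s ^ 3) := by
        rw [hw]; ring
      rw [this, hs, sub_self, mul_zero]
    have h3 : b * (w ^ 3 - 3 * b * (a + b) * w - 2 * b ^ 2 * (a + b)) = 0 := by rw [← h1]; exact h2
    exact (mul_eq_zero.mp h3).resolve_left hb
  -- `w² ≠ bc`
  have hden : w ^ 2 - b * (a + b) ≠ 0 := by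
    intro h0
    have hw2 : w ^ 2 = b * (a + b) := sub_eq_zero.mp h0
    have h4 : w ^ 3 - 3 * b * (a + b) * w - 2 * b ^ 2 * (a + b) = -(2 * b * (a + b)) * (w + b) := by
      have : w ^ 3 = w * w ^ 2 := by ring
      rw [this, hw2]; ring
    rw [h4] at hroot
    have h5 : w + b = 0 := (mul_eq_zero.mp hroot).resolve_left (by
      exact neg_ne_zero.mpr (mul_ne_zero (mul_ne_zero two_ne_zero hb) hc))
    have h6 : w = -b := by linarith
    rw [h6] at hw2
    have h7 : b * a = 0 := by nlinarith [hw2]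
    exact ha ((mul_eq_zero.mp h7).resolve_left hb)
  -- the Tschirnhaus image is a root of `p_{b,a}`
  set w₂ : ℚ := -(2 * a * b * (a + b)) / (w ^ 2 - b * (a + b)) with hw₂
  have hroot₂ : w₂ ^ 3 - 3 * a * (b + a) * w₂ - 2 * a ^ 2 * (b + a) = 0 := by
    have ht := roles_tschirnhaus a b w
    rw [hroot, mul_zero, zero_mul] at ht
    have : w₂ ^ 3 - 3 * a * (b + a) * w₂ - 2 * a ^ 2 * (b + a)
        = ((-(2 * a * b * (a + b))) ^ 3 - 3 * a * (a + b) * (-(2 * a * b * (a + b))) * (w ^ 2 - b * (a + b)) ^ 2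
            - 2 * a ^ 2 * (a + b) * (w ^ 2 - b * (a + b)) ^ 3) / (w ^ 2 - b * (a + b)) ^ 3 := by
      rw [hw₂]
      field_simp
      ring
    rw [this, ht, zero_div]
  -- read off the parameter for the role `b`
  refine ⟨w₂ / a, ?_⟩
  have h8 := root_identity_monic b a w₂
  rw [hroot₂, mul_zero] at h8
  have h9 : (b + a) * ((w₂ / a + 1) ^ 2 * (w₂ / a - 2)) - b * (w₂ / a) ^ 3
      = ((b + a) * ((w₂ + a) ^ 2 * (w₂ - 2 * a)) - b * w₂ ^ 3) / a ^ 3 := by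
    field_simp
  rw [h8, zero_div, sub_eq_zero] at h9
  exact h9

/-- R2d (M−). ON the locus, `c` is a cube up to a divisor of `8`: write `s = u/v` in lowest terms; then
`c·(u+v)²(u−2v) = a·u³` with `gcd(a, c) = 1` and `gcd(u³, (u+v)²(u−2v)) ∣ 8` (a common prime divides `gcd(u, v) = 1`
or `2`; `v₂ ≤ 3`), whence `c ∣ u³ ∣ 8c`. Certified: kit job (md), `c ≤ 200`: the reducible real roles are exactly
those with `g·c = u³`, `g ∣ 8`. [folklore] -/
theorem cube_of_realRoleParam {a b c : ℕ} (h : IsABCTriple a b c) (hp : RealRoleParam a b) :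
    ∃ u g : ℕ, g ∣ 8 ∧ u ^ 3 = g * c := by
  sorry

/-! ## R3 — a real resolvent cubic field exists (kernel-checked + the sign door) -/

set_option linter.unusedTactic false in
set_option linter.unreachableTactic false in
/-- R3a (kernel-checked, generic; = complex-k1 T4a). An irreducible `ψ₂` has a stem field of degree `3`. [folklore] -/
theorem exists_cubicField (W : WeierstrassCurve ℚ) (hirr : Irreducible W.twoTorsionPolynomial.toPoly) :
    ∃ (K : Type) (_ : Field K) (_ : NumberField K),
      Module.finrank ℚ K = 3 ∧ ∃ θ : K, aeval θ W.twoTorsionPolynomial.toPoly = 0 := by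
  classical
  set f := W.twoTorsionPolynomial.toPoly with hf
  haveI : Fact (Irreducible f) := ⟨hirr⟩
  have hf0 : f ≠ 0 := hirr.ne_zero
  have ha : W.twoTorsionPolynomial.a ≠ 0 := by
    rw [WeierstrassCurve.twoTorsionPolynomial]; norm_num
  have hdeg : f.natDegree = 3 := Cubic.natDegree_of_a_ne_zero ha
  haveI : Module.Finite ℚ (AdjoinRoot f) := (AdjoinRoot.powerBasis hf0).finite
  haveI : CharZero (AdjoinRoot f) := charZero_of_injective_algebraMap (algebraMap ℚ (AdjoinRoot f)).injective
  letI : NumberField (AdjoinRoot f) := NumberField.mk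
  refine ⟨AdjoinRoot f, inferInstance, inferInstance, ?_, AdjoinRoot.root f, ?_⟩
  · rw [(AdjoinRoot.powerBasis hf0).finrank, AdjoinRoot.powerBasis_dim, hdeg]
  · have h := AdjoinRoot.aeval_eq (f := f) f
    rw [AdjoinRoot.mk_self, Polynomial.aeval_def] at h
    rw [Polynomial.aeval_def]
    convert h using 2
    all_goals first | rfl | exact Subsingleton.elim _ _

/-- R3b. THE SIGN DOOR, positive direction (= k1-gen-5 keystone `2⁸Δ_min = I²·d_K`, kernel-checked in
`Cruxes/IndexSzpiro/StubIdeas1G5Sketch.lean` as `discr_neg_iff_Δ_neg`; `d_K ≠ 0`, `Δ ≠ 0` give the positive form):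
a cubic field with a root of the irreducible `ψ₂` of a curve with `Δ > 0` is totally real. With R1d every positive
pencil fibre is in the stub's class `𝒞⁺`. Consumed as a named hypothesis, not re-proved here. [folklore] -/
def SignDoorPos : Prop :=
  ∀ (W : WeierstrassCurve ℚ) [W.IsElliptic] (K : Type) [Field K] [NumberField K],
    Irreducible W.twoTorsionPolynomial.toPoly → Module.finrank ℚ K = 3 →
    (∃ θ : K, aeval θ W.twoTorsionPolynomial.toPoly = 0) → 0 < W.Δ → 0 < NumberField.discr K

/-! ## R4 — the captured member: `a ∣ 1728·Δ_min(W_{a,b})` -/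

/-- R4a (kernel-checked; = complex-k1 T5a). `den(j) ∣ |Δ_min|` for EVERY elliptic curve over `ℚ` (model-free form
of the tree's `den_j_dvd_natAbs_minimalDiscriminantInt`). [folklore] -/
theorem den_j_dvd_minimalDiscriminantNorm (W : WeierstrassCurve ℚ) [W.IsElliptic] :
    (W.j).den ∣ W.minimalDiscriminantNorm ℤ := by
  obtain ⟨C, hC⟩ := hasGlobalMinimalModel_rat_holds W
  haveI := hC
  have h1 := den_j_dvd_natAbs_minimalDiscriminantInt (C • W)
  rw [← minimalDiscriminantNorm_int_eq_natAbs_minimalDiscriminantInt_holds (C • W),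
    minimalDiscriminantNorm_smul_rat, variableChange_j] at h1
  exact h1

/-- R4b (S). `a ∣ 1728·den(j(W_{a,b}))` for an abc triple: `j = 1728c/a` (R1e) with `gcd(a, c) = 1`, so
`den j = a/gcd(a, 1728)` (Mathlib `Rat.den_div_eq_of_coprime` after cancelling the gcd). [folklore] -/
theorem dvd_mul_den_j {a b c : ℕ} (h : IsABCTriple a b c) [(jPencil a b).IsElliptic] :
    a ∣ 1728 * ((jPencil a b).j).den := by
  sorry

/-- R4 (S ∘ R4a). The captured member: `a ∣ 1728·|Δ_min(W_{a,b})|`. [folklore] -/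
theorem dvd_mul_minimalDiscriminantNorm {a b c : ℕ} (h : IsABCTriple a b c) [(jPencil a b).IsElliptic] :
    a ∣ 1728 * (jPencil a b).minimalDiscriminantNorm ℤ :=
  (dvd_mul_den_j h).trans (mul_dvd_mul_left _ (den_j_dvd_minimalDiscriminantNorm _))

/-! ## R5 — the conductor is supported on `rad(abc)` (M) -/

/-- R5 (M; same template as complex-k1 T6 and `TwoTorsionDictionary.radical_natAbs_dvd_two_mul_conductorNorm`).
`N(W_{a,b}) ∣ 2⁸·3⁵·rad(abc)²`: `f₂ ≤ 8`, `f₃ ≤ 5` (`conductorExponent_le_eight_holds`,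
`conductorExponent_le_five_of_natGenerator_eq_three_holds`), `f_p ≤ 2` for `p ≥ 5`
(`conductorExponent_le_two_of_five_le_natGenerator_holds`), `f_p = 0` for `p ∤ 6abc` (R1b +
`conductorExponent_eq_zero_of_not_dvd_Δ`); assemble with `conductorNorm_dvd_of_forall_conductorExponent_le`.
Sharper, not needed: `p ≥ 5`, `p ∣ a ⟹ f_p = 1` (R1a + `conductorExponent_eq_one_of_dvd_Δ_of_not_dvd_c₄`). [folklore] -/
theorem conductorNorm_jPencil_dvd {a b c : ℕ} (h : IsABCTriple a b c) [(jPencil a b).IsElliptic] :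
    (jPencil a b).conductorNorm ℤ ∣ 2 ^ 8 * 3 ^ 5 * (rad a b c) ^ 2 := by
  sorry

/-! ## R6 — the recognition theorems (M): the REAL stub implies polynomial abc -/

/-- `c` is a cube up to a divisor of `8` (the image of the `X₀(2)` locus, R2d). -/
def CubeUpToEight (c : ℕ) : Prop := ∃ u g : ℕ, g ∣ 8 ∧ u ^ 3 = g * c

/-- abc WITH EXPONENT `Λ` OFF THE CUBE SUMS: the tree's `GenEll.ABCWithExponent Λ` sentence restricted to the abc
triples whose `c` is not a cube up to `8`. A predicate; open for every `Λ` (it contains, e.g., every triple with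
squarefree `c`, and Stewart–Yu is exponential there too). -/
def ABCWithExponentOffCubes (Λ : ℝ) : Prop :=
  ∀ ε : ℝ, 0 < ε → ∃ C : ℝ, 0 < C ∧
    ∀ a b c : ℕ, IsABCTriple a b c → ¬ CubeUpToEight c →
      (c : ℝ) < C * ((rad a b c : ℕ) : ℝ) ^ (Λ * (1 + ε))

/-- **R6a (M) — `stub_realCubic ⟹ abc with exponent 16 off the cube sums`.** Given `ε`, take the stub's `C(ε)`;
for an abc triple with `¬ CubeUpToEight c` swap so that `a ≥ b` (`a ≥ c/2`); by R2d `¬ RealRoleParam a b`, so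
`ψ₂(W_{a,b})` is irreducible (R2c′); `W_{a,b}` is elliptic (R1c); `K` = stem field (R3a) is real (R3b + R1d); the
stub gives `Δ_min ≤ C·|d_K|·N^{6+ε}`; with R4 (`a ≤ 1728·Δ_min`), CLOSED support `ResolventDiscBounds`
(`Summit.ABC.ABC.Theorems.resolventDiscBounds_proof`: `|d_K| ≤ 1944·N²`) and R5 (`N ≤ 2⁸3⁵·rad²`):
`c/2 ≤ a ≤ 1728·1944·C·(2⁸3⁵)^{8+ε}·rad(abc)^{16+2ε}`, i.e. `c < C'·rad(abc)^{16(1+ε)}`. [folklore] -/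
theorem abcOffCubes_sixteen_of_stubReal (hsign : SignDoorPos) (h : StubReal) :
    ABCWithExponentOffCubes 16 := by
  sorry

/-- **R6a⁺ (M) — the sharp form: exponent 16 OFF `𝓑`.** `RealRoleParam a b` is symmetric (R2s′), so off the
locus BOTH roles are available and the role of the larger summand runs R6a's chain. [folklore] -/
theorem abc_sixteen_offB_of_stubReal (hsign : SignDoorPos) (h : StubReal) :
    ∀ ε : ℝ, 0 < ε → ∃ C : ℝ, 0 < C ∧
      ∀ a b c : ℕ, IsABCTriple a b c → ¬ RealRoleParam a b →
        (c : ℝ) < C * ((rad a b c : ℕ) : ℝ) ^ (16 * (1 + ε)) := by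
  sorry

/-- **R6c (S ∘ R6a) — calibration of the ROUTE CRUX through its real half**: `IndexSzpiro ⟹ abc₁₆ off cubes`
(complement to complex-k1 T8″ `IndexSzpiro ⟹ ABCWithExponent 8` through the complex half). [folklore] -/
theorem abcOffCubes_sixteen_of_indexSzpiro (hsign : SignDoorPos)
    (h : Summit.ABC.ABC.Theses.CubicResolventAllowance.IndexSzpiro) : ABCWithExponentOffCubes 16 :=
  abcOffCubes_sixteen_of_stubReal hsign (stubReal_of_indexSzpiro h)

/-! ## R7 — the degenerate locus is ONE explicit thin family: the binomial cubes `𝓑` (kernel-checked) -/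

/-- R7a (kernel-checked). The binomial line: `n²(n+3m) + m²(m+3n) = (m+n)³`. [folklore] -/
theorem binomial_line (m n : ℤ) : n ^ 2 * (n + 3 * m) + m ^ 2 * (m + 3 * n) = (m + n) ^ 3 := by
  ring

/-- R7b (kernel-checked). Every binomial-cube triple `𝓑 = {(n²(n+3m), m²(m+3n), (m+n)³)/g}` is on the locus, in
both roles (parameters `s = −(m+n)/m`, `−(m+n)/n`). Conversely (R2d's parametrisation, `n = u+v`, `m = −v`) the
locus IS `𝓑`: e.g. `(7,20,27)`, `(11,16,27)`, `(2,25,27)` (`g = 8`), `(243,100,343)` (`m = −2`, `n = 9`),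
`(13,1445,1458)` (`g = 4`); 59 triples with `c ≤ 2000` (kit j344791/j344796), density `≍ X^{2/3}`. [folklore] -/
theorem realRoleParam_line (m n : ℚ) (hm : m ≠ 0) (hn : n ≠ 0) :
    RealRoleParam (n ^ 2 * (n + 3 * m)) (m ^ 2 * (m + 3 * n)) ∧
      RealRoleParam (m ^ 2 * (m + 3 * n)) (n ^ 2 * (n + 3 * m)) := by
  refine ⟨⟨-(m + n) / m, ?_⟩, ⟨-(m + n) / n, ?_⟩⟩
  · field_simp
    ring
  · field_simp
    ring

/-- R7c (kernel-checked). A concrete abc HIT in `𝓑`: `3⁵ + 2²5² = 7³` (`rad = 210 < 343`), parameters `7/2`, `7/3` —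
so `𝓑` is not disjoint from the interesting triples, but it is thin. [folklore] -/
theorem realRoleParam_243_100 : RealRoleParam 243 100 ∧ RealRoleParam 100 243 :=
  ⟨⟨7 / 2, by norm_num⟩, ⟨7 / 3, by norm_num⟩⟩

/-! ## R7′ — the depth-one DISPATCH on `𝓑` (typed; the Diophantine residual is the honest open input) -/

/-- The primitive triple underlying `u + v = (u + v)` (any signs) is in `𝓑`, i.e. on the locus in some role. -/
def TripleInB (u v : ℚ) : Prop :=
  RealRoleParam u v ∨ RealRoleParam (-u) (u + v) ∨ RealRoleParam (-v) (u + v)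

/-- For a `𝓑`-triple with parameters `(m, n)`: the three DERIVED triples `{|m|,|n|,|m+n|}`, `{|m|,3|n|,·}`,
`{3|m|,|n|,·}` — radicals dividing `6·rad(abc)` (`m ∣ gb`, `n ∣ ga`, `m+3n ∣ gb`, `3m+n ∣ ga`, `m+n ∣ (gc)^{1/3}`),
largest members `≥ (gc)^{1/3}/3` — are ALL in `𝓑` again. -/
def DispatchResidual (m n : ℤ) : Prop :=
  TripleInB m n ∧ TripleInB m (3 * n) ∧ TripleInB (3 * m) n

/-- THE OPEN INPUT of the full real-half calibration: only finitely many coprime `(m, n)` survive the depth-one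
dispatch. Each conjunct forces the largest member of a derived triple to be a cube up to `8` (R2d), so the residual
lies on finitely many cubic Fermat curves `αx³ + βy³ = γz³` with `αβγ ∣ 2⁶3³` (e.g. `m+n`, `m+3n`, `3m+n` cubes ⟹
`v³ + w³ = 4u³`, no solutions — Euler/Legendre); finiteness of their rational points (rank 0) is what is asserted;
a positive-rank member would make this FALSE as typed and the dispatch would need depth two. Searched (kit j344802): among
1 596 422 coprime `(m,n)` with `|m|, n ≤ 1500` the residual is EMPTY (`D₀ ∈ 𝓑`: 175; `D₀` and one `Sᵢ`: 5; all three: 0). -/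
def DispatchResidualFinite : Prop :=
  Set.Finite {p : ℤ × ℤ | IsCoprime p.1 p.2 ∧ 0 < p.1 + p.2 ∧ DispatchResidual p.1 p.2}

/-- **R7d (L, conditional) — `stub_realCubic ⟹ ABCWithExponent 48`, the tree's sentence for ALL triples**, given the
Diophantine finiteness: off `𝓑` use R6a⁺ (exponent 16); on `𝓑` one of the derived triples is off `𝓑` (else
`DispatchResidual`, finitely many triples, absorbed in `C`), its largest member `M ≥ (gc)^{1/3}/3` obeys
`M < C·rad^{16(1+ε)}` with `rad ∣ 6·rad(abc)`, so `c ≤ 27M³ < C'·rad(abc)^{48(1+ε)}`. [folklore] -/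
theorem abc48_of_stubReal (hfin : DispatchResidualFinite) (hsign : SignDoorPos) (h : StubReal) :
    GenEll.ABCWithExponent 48 := by
  sorry

/-! ## R8 — the Hesse / `X₀(3)` pencil `V_{a,b}`: the only other low-index real pencil — same invariant shape, and (R9c) the SAME cubic field -/

/-- The integral Hesse pencil `V_{a,b} : Y² = X³ − 27·c₄·X − 54·c₆` with `c₄ = 9c(9a+b)`, `c₆ = 27c(27a²+18ab−b²)`,
`c = a + b` (the `X₀(3)` family `j = (t+27)(t+3)³/t` at `t = 27a/b`). -/
def hPencilInt (a b : ℤ) : WeierstrassCurve ℤ :=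
  ⟨0, 0, 0, -243 * (a + b) * (9 * a + b), -1458 * (a + b) * (27 * a ^ 2 + 18 * a * b - b ^ 2)⟩

/-- `V_{a,b}` over `ℚ`. -/
abbrev hPencil (a b : ℤ) : WeierstrassCurve ℚ := (hPencilInt a b).baseChange ℚ

/-- R8a (kernel-checked). The `X₀(3)` identity (`j − 1728 = (t²+18t−27)²/t`): `c(9a+b)³ − (27a²+18ab−b²)² = 64ab³`
for `c = a + b`. [folklore] -/
theorem hesse_identity (a b : ℚ) :
    (a + b) * (9 * a + b) ^ 3 - (27 * a ^ 2 + 18 * a * b - b ^ 2) ^ 2 = 64 * a * b ^ 3 := by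
  ring

/-- R8b (kernel-checked). `c₄(V_{a,b}) = 2⁴3⁶·c(9a+b)` — prime to `ab` away from `3`: BOTH summands are
multiplicative members. [folklore] -/
theorem hPencilInt_c₄ (a b : ℤ) : (hPencilInt a b).c₄ = 2 ^ 4 * 3 ^ 6 * ((a + b) * (9 * a + b)) := by
  simp only [hPencilInt, WeierstrassCurve.c₄, WeierstrassCurve.b₂, WeierstrassCurve.b₄]
  ring

/-- R8c (kernel-checked). `Δ(V_{a,b}) = 2¹²3¹⁵·a·b³·(a+b)²` — POSITIVE, bad primes `⊆ 6abc` (the factor `9a+b`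
of `c₄` never meets `Δ` away from `3`: good reduction there, no twist needed). [folklore] -/
theorem hPencilInt_Δ (a b : ℤ) : (hPencilInt a b).Δ = 2 ^ 12 * 3 ^ 15 * (a * b ^ 3 * (a + b) ^ 2) := by
  simp only [hPencilInt, WeierstrassCurve.Δ, WeierstrassCurve.b₂, WeierstrassCurve.b₄, WeierstrassCurve.b₆,
    WeierstrassCurve.b₈]
  ring

/-- R8c′ (kernel-checked). `Δ(V_{a,b}/ℚ)`. [folklore] -/
theorem hPencil_Δ (a b : ℤ) :
    (hPencil a b).Δ = (2 ^ 12 * 3 ^ 15 : ℚ) * ((a : ℚ) * b ^ 3 * (a + b) ^ 2) := by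
  rw [hPencil, WeierstrassCurve.baseChange, WeierstrassCurve.map_Δ, hPencilInt_Δ, eq_intCast]
  push_cast
  ring

/-- R8b′ (kernel-checked). `c₄(V_{a,b}/ℚ)`. [folklore] -/
theorem hPencil_c₄ (a b : ℤ) :
    (hPencil a b).c₄ = (2 ^ 4 * 3 ^ 6 : ℚ) * (((a : ℚ) + b) * (9 * a + b)) := by
  rw [hPencil, WeierstrassCurve.baseChange, WeierstrassCurve.map_c₄, hPencilInt_c₄, eq_intCast]
  push_cast
  ring

/-- R8d (kernel-checked). `V_{a,b}` is elliptic for `ab(a+b) ≠ 0`, with `Δ > 0` for `a, b > 0`. [folklore] -/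
theorem hPencil_isElliptic {a b : ℤ} (ha : a ≠ 0) (hb : b ≠ 0) (hc : a + b ≠ 0) :
    (hPencil a b).IsElliptic := by
  refine ⟨?_⟩
  rw [hPencil_Δ, isUnit_iff_ne_zero]
  have ha' : (a : ℚ) ≠ 0 := by exact_mod_cast ha
  have hb' : (b : ℚ) ≠ 0 := by exact_mod_cast hb
  have hc' : ((a : ℚ) + b) ≠ 0 := by exact_mod_cast hc
  exact mul_ne_zero (by norm_num) (mul_ne_zero (mul_ne_zero ha' (pow_ne_zero 3 hb')) (pow_ne_zero 2 hc'))

theorem hPencil_Δ_pos {a b : ℤ} (ha : 0 < a) (hb : 0 < b) : 0 < (hPencil a b).Δ := by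
  rw [hPencil_Δ]
  have ha' : (0 : ℚ) < a := by exact_mod_cast ha
  have hb' : (0 : ℚ) < b := by exact_mod_cast hb
  positivity

/-- R8e (kernel-checked). `j(V_{a,b}) = 27·c·(9a+b)³/(a·b³)`: BOTH summands sit in the denominator (`n_p = v_p(a)`,
`3v_p(b)`), and `ab³ ≥ max(a, b) ≥ c/2` — no role subtlety. [folklore] -/
theorem hPencil_j {a b : ℤ} (ha : a ≠ 0) (hb : b ≠ 0) (hc : a + b ≠ 0) [(hPencil a b).IsElliptic] :
    (hPencil a b).j = 27 * ((a : ℚ) + b) * (9 * a + b) ^ 3 / (a * b ^ 3) := by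
  have ha' : (a : ℚ) ≠ 0 := by exact_mod_cast ha
  have hb' : (b : ℚ) ≠ 0 := by exact_mod_cast hb
  have hc' : ((a : ℚ) + b) ≠ 0 := by exact_mod_cast hc
  rw [WeierstrassCurve.j, Units.val_inv_eq_inv_val, WeierstrassCurve.coe_Δ', hPencil_Δ, hPencil_c₄]
  field_simp
  ring

/-! ## R9 — why every real pencil sees the SAME cubic field: Cardano data and two Kummer identities (kernel-checked) -/

/-- R9a (kernel-checked). Cardano data `Q² − P³` of the three monic cubics `w³ − 3Pw − 2Q`:
`p_{a,b}` (`P = bc`, `Q = b²c`), `p_{b,a}` (`P = ac`, `Q = a²c`), `p_V` (`P = c(9a+b)`, `Q = c(27a²+18ab−b²)`, the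
Hesse pencil in the normalisation `x = 9w`): `−ab³c²`, `−a³bc²`, `−64ab³c²`. All three are `−ab` times a square:
the Cardano radical is `δ = √(−ab)` in every case, the quadratic resolvent is `ℚ(√(3ab))`, and the cubic field is the
Kummer-type field of `α = Q + (□)δ ∈ L = ℚ(δ)` modulo cubes and rationals. [folklore] -/
theorem cardano_data (a b : ℚ) :
    (b ^ 2 * (a + b)) ^ 2 - (b * (a + b)) ^ 3 = -(a * b) * (b * (a + b)) ^ 2 ∧
    (a ^ 2 * (a + b)) ^ 2 - (a * (a + b)) ^ 3 = -(a * b) * (a * (a + b)) ^ 2 ∧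
    ((a + b) * (27 * a ^ 2 + 18 * a * b - b ^ 2)) ^ 2 - ((a + b) * (9 * a + b)) ^ 3
      = -(a * b) * (8 * b * (a + b)) ^ 2 := by
  refine ⟨by ring, by ring, by ring⟩

/-- R9b (kernel-checked). KUMMER IDENTITY FOR THE TWO ROLES: with `δ² = −ab`, `α₁ = bc(b + δ)` (role `a`) and
`α₂ = ac(a + δ)` (role `b`) satisfy `α₁·α₂ = −(cδ)³` — a cube. So `α₂ ≡ ᾱ₁` modulo cubes: the same cubic field
(this is the algebra behind R2s). [folklore] -/
theorem kummer_roles {R : Type*} [CommRing R] (a b δ : R) (hδ : δ ^ 2 = -(a * b)) :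
    (b * (a + b) * (b + δ)) * (a * (a + b) * (a + δ)) = -((a + b) * δ) ^ 3 := by
  linear_combination (a * b * (a + b) ^ 2 + (a + b) ^ 3 * δ) * hδ

/-- R9c (kernel-checked). KUMMER IDENTITY FOR THE HESSE PENCIL: `α_V = c(27a²+18ab−b²) + 8bcδ` and `ᾱ₁ = bc(b − δ)`
satisfy `α_V·ᾱ₁ = (−c(b − 3δ))³` — a cube. So `α_V ≡ α₁`: the `X₀(3)` pencil `V_{a,b}` (and its Fricke partner
`V_{b,a}`, 3-isogenous) has the SAME 2-division field as `W_{a,b}`; its failure locus is `𝓑` again and it cannot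
rescue the residual (certified: 13 680/13 680 field isomorphisms, 0 mixed patterns, kit j344796 blocks 3–4).
Recorded so that nobody re-walks the second pencil. [folklore] -/
theorem kummer_hesse {R : Type*} [CommRing R] (a b δ : R) (hδ : δ ^ 2 = -(a * b)) :
    ((a + b) * (27 * a ^ 2 + 18 * a * b - b ^ 2) + 8 * b * (a + b) * δ) * (b * (a + b) * (b - δ))
      = (-((a + b) * (b - 3 * δ))) ^ 3 := by
  linear_combination ((a + b) ^ 2 * (-8 * b ^ 2 + 27 * b * (a + b) - 27 * (a + b) * δ)) * hδ

/-! ## R10 — summary: the sandwich, by name (kernel-checked modulo the named proposals) -/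

/-- R10. `SzpiroConjecture ⟹ StubReal` (R0b); `SignDoorPos → StubReal ⟹ abc₁₆ off cubes` (R6a);
`DispatchResidualFinite → SignDoorPos → StubReal ⟹ ABCWithExponent 48` (R7d): the real stub sits between Szpiro
and polynomial abc; no import short of polynomial abc closes it. [folklore] -/
theorem stubReal_sandwich :
    (SzpiroConjecture → StubReal) ∧ (SignDoorPos → StubReal → ABCWithExponentOffCubes 16) ∧
      (DispatchResidualFinite → SignDoorPos → StubReal → GenEll.ABCWithExponent 48) :=
  ⟨stubReal_of_szpiro, abcOffCubes_sixteen_of_stubReal, abc48_of_stubReal⟩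

end Summit.ABC.ABC.Cruxes.IndexSzpiro.StubIdeasRealCubic1G7

end
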